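import Summits.BirchSwinnertonDyer.BirchSwinnertonDyer.Theorems.EisensteinPrimesBSDpOnCellCAccumHelpersThree
import HarnessLib

/-!
# `p`-adic accumulation of rational divisibilities along a convergent sequence of fibres — part 4: the consumer schema `C_C_pow_mul_limit_mem_of_members` / `C_C_pow_mul_limit_mem_of_uniform_members`
# (cell `bsd-eis`, crux 4 `BSDpOnCellC` stmt-BirchSwinnertonDyer-19034, line «accum» — the ACCUMULATION LEVER behind the registered stub
# `stub_twoVarRatDivPNew` (crystal v7+); mathematics and Lean text by ideator bsd-idea-12 g15, `HOME pub/ideators/bsd-idea-12/bc/AccumHelpers.lean`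
# sha16 d22ccc6e94281a99 = §0a of `Cruxes/BSDpOnCellC/Lines/accum.lean` v1.5, sorry-free, Mathlib-only; critic idea-crit-14 V99 N2 asked for it to be
# landed as a built module; landed VERBATIM (split into 4 files ≤ 400 l.; part 4/4) by the LEAD cruxlead-19034 g0, `--supports -19034`)

HONEST FRAMING: pure commutative algebra over Mathlib (power series over a complete DVR; Weierstrass division by `X − x`; `π`-adic limits); standard
axioms, no `sorry`, no instance, no notation; nothing about any curve, Selmer group or `L`-function is asserted. It is the INTENDED PROOF MACHINERY of
the stub (member-wise rational divisibilities at the good crystalline members of a Hida branch ACCUMULATE `p`-adically to the `p`-new fibre), not a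
proof of the stub: the member inputs and the fibre control remain. Contents of the whole module (source docstring):

# `p`-adic accumulation of rational divisibilities along a convergent sequence of fibres
(helper module candidate; pure commutative algebra over Mathlib; standard axioms; no `sorry`)

Source: ideator `bsd-idea-12` g15, line «accum» on crux `BSDpOnCellC` (stmt-BirchSwinnertonDyer-19034), where §0a of
`Summits/BirchSwinnertonDyer/BirchSwinnertonDyer/Cruxes/BSDpOnCellC/Lines/accum.lean` (v1.5) carries the same declarations
inside the crux namespace. Critic idea-crit-14 VERDICT #99 N2 asked that this algebra be landed as a built helper module by a
prover/LEAD (`ledger propose … --supports stmt-BirchSwinnertonDyer-19034 --as helper`); this file is the ready source.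

SETTING. `𝒪` a complete DVR (in the application `ℤ_p`), `R := 𝒪⟦X⟧⟦T₂⟧⟦T₁⟧` (as `PowerSeries (PowerSeries (PowerSeries 𝒪))`,
innermost variable `X`), fibre ring `S := 𝒪⟦T₂⟧⟦T₁⟧`, `[X − y] := C (C (X − C y))`.

CONTENTS.
* `co`, `co_C_C_mul`, `eq_zero_of_co_eq_zero` — double coefficients.
* Theorem A `exists_eq_C_C_pow_mul_unit_of_coeff_adic_limit` — closedness of `π^ℕ·(units)` in `S` under coefficientwise
  `π`-adic convergence uniform in the index; `finite_pow_dvd_of_dvr`.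
* Evaluation calculus `evAt` / `EvAt` at a point of the maximal ideal = Weierstrass division by the degree-one distinguished
  polynomial `X − x` (`Polynomial.IsDistinguishedAt.algEquivQuotient`, `Polynomial.quotientSpanXSubCAlgEquiv`): `evAt_C`,
  `evAt_X`, `evAt_eq_zero_iff` (kernel `= (X − C x)`), `sub_dvd_evAt_sub_evAt`, `EvAt_C_C`, `co_EvAt`,
  `C_C_dvd_of_EvAt_eq_zero`, `EvAt_lift`.
* Theorem U₁ `not_dvd_of_uniform_members` — uniform member constant and `[X − x_∞] ∤ L` ⟹ `[X − x_∞] ∤ F`.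
* Solving lemma `exists_mul_eq_of_forall_exists_mod` — `A·Z ≡ B (mod π^m)` solvable in `S` for all `m` ⟹ `A·Z = B` solvable
  (content decomposition; a unit-content series is a non-zero-divisor modulo every `π^m` because `(𝒪/π)⟦T₂⟧⟦T₁⟧` is a domain —
  `C_C_dvd_of_dvd_mul`, `C_C_pow_dvd_of_dvd_mul`; Cauchy + `IsPrecomplete`).
* Theorem U₂ `dvd_limit_of_uniform_members`, `uniform_variant_holds` — the uniform-constant accumulation lemma.
* Content decomposition `exists_eq_C_C_pow_mul_not_dvd`; Theorem P `dvd_limit_of_members` — the accumulation lemma with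
  VARYING member constants: `∀ k, p^{c_k}·L ∈ (F, [X − x_k])`, `x_k → x_∞` `p`-adically, `[X − x_∞] ∤ F` ⟹
  `∃ a, p^a·L ∈ (F, [X − x_∞])` (no unique factorisation used).
* Consumer schema `C_C_pow_mul_limit_mem_of_members` / `C_C_pow_mul_limit_mem_of_uniform_members` — an ideal `I ∋ p^m·F(x_∞)`
  receives `p^{c'}·L(x_∞)`.

[cite: BuyukbodukLei2020, App. A Prop. 25 (arXiv:2008.08411 p. 51: the exact, Zariski-infinite, uniform-constant, upward sibling
«a divisibility criterion in regular rings»)]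
-/

set_option autoImplicit false
set_option linter.dupNamespace false

noncomputable section

namespace Summit.BirchSwinnertonDyer.BirchSwinnertonDyer.Theorems.AccumHelpers

open PowerSeries

/-! ### Consumer schema (critic V99 N1): how the lemma is APPLIED — an ideal `I` of the fibre ring containing the
limit fibre of `F` up to `p^m` (control) receives the limit fibre of `L` up to `p^c`. -/

section Consumer

open Filter

/-- Helper `C_C_pow_mul_limit_mem_of_members` of the accumulation lemma (line «accum» §0a; statement as displayed; pure commutative algebra). [folklore] -/
theorem C_C_pow_mul_limit_mem_of_members {p : ℕ} [Fact p.Prime]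
    (𝒪 : Type*) [CommRing 𝒪] [IsDomain 𝒪] [IsDiscreteValuationRing 𝒪] [Algebra ℤ_[p] 𝒪]
    [IsAdicComplete (IsLocalRing.maximalIdeal 𝒪) 𝒪] (hp : Irreducible ((p : ℕ) : 𝒪))
    (F L : PowerSeries (PowerSeries (PowerSeries 𝒪))) (x : ℕ → ℤ_[p]) (xlim : ℤ_[p]) (c : ℕ → ℕ)
    (hxk : ∀ k, ‖x k‖ < 1) (hxlim : ‖xlim‖ < 1)
    (hconv : Tendsto x atTop (nhds xlim))
    (hmem : ∀ k, ∃ G U : PowerSeries (PowerSeries (PowerSeries 𝒪)),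
      PowerSeries.C (PowerSeries.C (PowerSeries.C (((p : ℕ) : 𝒪) ^ c k))) * L =
        F * G + PowerSeries.C (PowerSeries.C (PowerSeries.X - PowerSeries.C (algebraMap ℤ_[p] 𝒪 (x k)))) * U)
    (hF : ¬ (PowerSeries.C (PowerSeries.C (PowerSeries.X - PowerSeries.C (algebraMap ℤ_[p] 𝒪 xlim))) ∣ F))
    (hxl : algebraMap ℤ_[p] 𝒪 xlim ∈ IsLocalRing.maximalIdeal 𝒪)
    (I : Ideal (PowerSeries (PowerSeries 𝒪))) (m : ℕ)
    (hcontrol : PowerSeries.C (PowerSeries.C (((p : ℕ) : 𝒪) ^ m)) * EvAt (algebraMap ℤ_[p] 𝒪 xlim) hxl F ∈ I) :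
    ∃ c' : ℕ, PowerSeries.C (PowerSeries.C (((p : ℕ) : 𝒪) ^ c')) * EvAt (algebraMap ℤ_[p] 𝒪 xlim) hxl L ∈ I := by
  obtain ⟨a, G, U, hGU⟩ := dvd_limit_of_members 𝒪 hp F L x xlim c hxk hxlim hconv hmem hF
  refine ⟨m + a, ?_⟩
  have e1 : EvAt (algebraMap ℤ_[p] 𝒪 xlim) hxl
      (PowerSeries.C (PowerSeries.C (PowerSeries.C (((p : ℕ) : 𝒪) ^ a)))) =
      PowerSeries.C (PowerSeries.C (((p : ℕ) : 𝒪) ^ a)) := by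
    rw [EvAt_C_C, evAt_C]
  have e3 : EvAt (algebraMap ℤ_[p] 𝒪 xlim) hxl
      (PowerSeries.C (PowerSeries.C (PowerSeries.X - PowerSeries.C (algebraMap ℤ_[p] 𝒪 xlim)))) = 0 := by
    rw [EvAt_C_C, map_sub, evAt_X, evAt_C, sub_self, map_zero, map_zero]
  have hEv := congrArg (EvAt (algebraMap ℤ_[p] 𝒪 xlim) hxl) hGU
  simp only [map_mul, map_add, e1, e3, zero_mul, add_zero] at hEv
  -- hEv : C(C(p^a)) · L(x_∞) = F(x_∞) · Ev G
  have : PowerSeries.C (PowerSeries.C (((p : ℕ) : 𝒪) ^ (m + a))) * EvAt (algebraMap ℤ_[p] 𝒪 xlim) hxl L =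
      (PowerSeries.C (PowerSeries.C (((p : ℕ) : 𝒪) ^ m)) * EvAt (algebraMap ℤ_[p] 𝒪 xlim) hxl F) *
        EvAt (algebraMap ℤ_[p] 𝒪 xlim) hxl G := by
    rw [pow_add, map_mul, map_mul, mul_assoc, hEv, mul_assoc]
  rw [this]
  exact I.mul_mem_right _ hcontrol

/-- uniform-constant version: torsion (`F(x_∞) ≠ 0`) is an OUTPUT, from `[X − x_∞] ∤ L`. -/
theorem C_C_pow_mul_limit_mem_of_uniform_members {p : ℕ} [Fact p.Prime]
    (𝒪 : Type*) [CommRing 𝒪] [IsDomain 𝒪] [IsDiscreteValuationRing 𝒪] [Algebra ℤ_[p] 𝒪]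
    [IsAdicComplete (IsLocalRing.maximalIdeal 𝒪) 𝒪] (hp : Irreducible ((p : ℕ) : 𝒪))
    (F L : PowerSeries (PowerSeries (PowerSeries 𝒪))) (x : ℕ → ℤ_[p]) (xlim : ℤ_[p]) (c : ℕ)
    (hxk : ∀ k, ‖x k‖ < 1) (hxlim : ‖xlim‖ < 1)
    (hconv : Tendsto x atTop (nhds xlim))
    (hmem : ∀ k, ∃ G U : PowerSeries (PowerSeries (PowerSeries 𝒪)),
      PowerSeries.C (PowerSeries.C (PowerSeries.C (((p : ℕ) : 𝒪) ^ c))) * L =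
        F * G + PowerSeries.C (PowerSeries.C (PowerSeries.X - PowerSeries.C (algebraMap ℤ_[p] 𝒪 (x k)))) * U)
    (hL : ¬ (PowerSeries.C (PowerSeries.C (PowerSeries.X - PowerSeries.C (algebraMap ℤ_[p] 𝒪 xlim))) ∣ L))
    (hxl : algebraMap ℤ_[p] 𝒪 xlim ∈ IsLocalRing.maximalIdeal 𝒪)
    (I : Ideal (PowerSeries (PowerSeries 𝒪))) (m : ℕ)
    (hcontrol : PowerSeries.C (PowerSeries.C (((p : ℕ) : 𝒪) ^ m)) * EvAt (algebraMap ℤ_[p] 𝒪 xlim) hxl F ∈ I) :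
    EvAt (algebraMap ℤ_[p] 𝒪 xlim) hxl F ≠ 0 ∧
    PowerSeries.C (PowerSeries.C (((p : ℕ) : 𝒪) ^ (m + c))) * EvAt (algebraMap ℤ_[p] 𝒪 xlim) hxl L ∈ I := by
  have hF := not_dvd_of_uniform_members 𝒪 hp F L x xlim c hxk hxlim hconv hmem hL
  refine ⟨fun h0 => hF (C_C_dvd_of_EvAt_eq_zero _ hxl F h0), ?_⟩
  obtain ⟨G, U, hGU⟩ := dvd_limit_of_uniform_members 𝒪 hp F L x xlim c hxk hxlim hconv hmem
  have e1 : EvAt (algebraMap ℤ_[p] 𝒪 xlim) hxl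
      (PowerSeries.C (PowerSeries.C (PowerSeries.C (((p : ℕ) : 𝒪) ^ c)))) =
      PowerSeries.C (PowerSeries.C (((p : ℕ) : 𝒪) ^ c)) := by
    rw [EvAt_C_C, evAt_C]
  have e3 : EvAt (algebraMap ℤ_[p] 𝒪 xlim) hxl
      (PowerSeries.C (PowerSeries.C (PowerSeries.X - PowerSeries.C (algebraMap ℤ_[p] 𝒪 xlim)))) = 0 := by
    rw [EvAt_C_C, map_sub, evAt_X, evAt_C, sub_self, map_zero, map_zero]
  have hEv := congrArg (EvAt (algebraMap ℤ_[p] 𝒪 xlim) hxl) hGU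
  simp only [map_mul, map_add, e1, e3, zero_mul, add_zero] at hEv
  have : PowerSeries.C (PowerSeries.C (((p : ℕ) : 𝒪) ^ (m + c))) * EvAt (algebraMap ℤ_[p] 𝒪 xlim) hxl L =
      (PowerSeries.C (PowerSeries.C (((p : ℕ) : 𝒪) ^ m)) * EvAt (algebraMap ℤ_[p] 𝒪 xlim) hxl F) *
        EvAt (algebraMap ℤ_[p] 𝒪 xlim) hxl G := by
    rw [pow_add, map_mul, map_mul, mul_assoc, hEv, mul_assoc]
  rw [this]
  exact I.mul_mem_right _ hcontrol

end Consumer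

end Summit.BirchSwinnertonDyer.BirchSwinnertonDyer.Theorems.AccumHelpers

end
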